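import Literature.Geometry.Lorentzian.CoordBochner
import Literature.Geometry.Lorentzian.CoordCurvatureRicciIdentity
import Literature.Geometry.Lorentzian.CoordEntropyFormula
import HarnessLib

/-!
# Metric compatibility of the pairing of bilinear forms, and the Hessian and Laplacian of a
# quadratic function `P(β) = ½(c (tr β)² − |β|²)` of a tensor field, in coordinates

A further layer of the coordinate tensor calculus (`CoordCurvature`, `CoordBianchi`,
`CoordCurvatureRicciIdentity`, `CoordEntropyEvolution`): metric components
`G : E → (E →L E →L ℝ)`, smooth, symmetric and nondegenerate on an open set `V` (`IsMetricOn G V`),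
`Γ = chrAt G`, `♯ = sharpAt G`, metric trace `mtrAt`, metric pairing of bilinear forms
`pairAt G y α β = tr((♯α)(♯β))`, covariant derivatives `cov₂At`, `cov₃At` along constant fields.

Support file for the named fact
`Literature.Geometry.Riemannian.gurskyViaclovsky_hessianEstimate_weighted_four`
(Gursky–Viaclovsky 2003, Prop. 6; Chen 2005, Thm. 1 (a)). The path equation is
`σ₂(A^t_u) = f²` with `2σ₂(B) = (tr B)² − |B|²` and `A^t = A¹ + s(tr A¹)g`, i.e.
`½(c (tr W)² − |W|²) = Φ` for the conformal Schouten tensor `W` and `c = 1 + 6s(1+2s)`; the proof of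
the `C²` estimate differentiates this scalar identity twice (Chen 2005, §3: `F^{ij}W_{ij,k} = (f)_k`,
`F^{ij}W_{ij,kk} + F^{ij,rs}W_{ij,k}W_{rs,k} = Δf`; Gursky–Viaclovsky 2003, §2, (derivT):
`(d/ds)σ₂(A_s) = Σ T₁(A_s)_{ij}(d/ds)(A_s)_{ij}`). Here, for a field of bilinear forms `β`:

* `IsMetricOn.fderiv_sharpAt_comp` — **`∂_Y(♯∘α) = ♯∘∇_Yα + [♯∘α, Γ_Y]`** (`∇♯ = 0`);
* `IsMetricOn.fderiv_pairAt` — **`∂_Y⟨α,β⟩_G = ⟨∇_Yα,β⟩_G + ⟨α,∇_Yβ⟩_G`** for all fields `α, β`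
  differentiable at the point (O'Neill 1983, Ch. 3, p. 86; the commutator terms cancel by the
  cyclicity of the trace);
* `IsMetricOn.fderiv_quadratic` — `∂_Y P(β) = c tr β tr(∇_Yβ) − ⟨β,∇_Yβ⟩ =: B_c(β, ∇_Yβ)`;
* `IsMetricOn.hessAt_quadratic` — **`Hess P(β)(X,Y) = B_c(∇_Xβ,∇_Yβ) + B_c(β, ∇²_{X,Y}β)`**;
* `IsMetricOn.lapAt_quadratic` — `ΔP(β) = Σ g^{kl}B_c(∇_kβ,∇_lβ) + Σ g^{kl}B_c(β,∇²_{b_k,b_l}β)`;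
* helpers: `IsMetricOn.differentiableAt_mtrAt_comp`, `IsMetricOn.differentiableAt_pairAt_comp`,
  `IsMetricOn.contDiffOn_quadratic`, `cov₂At_cov₂At_apply`
  (`∇_X(y ↦ (∇β)_y(Y;·,·)) = ∇²_{X,Y}β + ∇_{Γ(X,Y)}β`).

Everything is by the Fréchet calculus on constant fields of the earlier layers; everything is
proved, and no definition and no statement of `Prop` type is introduced.

## References

* B. O'Neill, *Semi-Riemannian geometry with applications to relativity*, Academic Press 1983,
  Ch. 3, Prop. 3.13 and p. 86 (contraction and type-changing commute with `∇`). [ONeill1983]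
* P. Topping, *Lectures on the Ricci flow*, LMS Lecture Note Series 325, CUP 2006, §2.1. [Topping2006]
* S. Chen, *Local estimates for some fully nonlinear elliptic equations*, IMRN 2005:63, §3. [Chen2005]
* M. J. Gursky, J. A. Viaclovsky, J. Differential Geom. 63 (2003), §2 ((derivT), `T₁`), Prop. 6.
  [GurskyViaclovsky2003]
-/

noncomputable section


set_option maxSynthPendingDepth 3

open Set Filter ContinuousLinearMap Module
open scoped Topology ContDiff

namespace Literature.Geometry.Lorentzian

namespace MetricCoord

variable {E : Type*} [NormedAddCommGroup E] [NormedSpace ℝ E] [CompleteSpace E]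
  {G : E → E →L[ℝ] E →L[ℝ] ℝ} {V : Set E} {x : E}

/-! ### The covariant derivative of the endomorphism `♯ ∘ α` -/

/-- **`D_Y(♯ ∘ α) = ♯ ∘ ∇_Y α + [♯∘α, Γ_Y]`**: the derivative of the field of endomorphisms
`y ↦ ♯_y ∘ α_y` (index raising of a field of bilinear forms) along `Y` is the raised covariant
derivative plus the commutator with `Γ_Y` — i.e. `∇_Y (♯α) = ♯(∇_Y α)`, `∇♯ = 0`
(O'Neill 1983, Ch. 3, Prop. 3.13 ff.: type-changing commutes with `∇`). [cite: ONeill1983, Ch. 3, p. 86] -/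
theorem IsMetricOn.fderiv_sharpAt_comp (hG : IsMetricOn G V) (hx : x ∈ V)
    {α : E → E →L[ℝ] E →L[ℝ] ℝ} (hα : DifferentiableAt ℝ α x) (Y : E) :
    fderiv ℝ (fun y ↦ (sharpAt G y).comp (α y)) x Y =
      (sharpAt G x).comp (cov₂At G α x Y) + ((sharpAt G x).comp (α x)).comp (chrAt G x Y)
        - (chrAt G x Y).comp ((sharpAt G x).comp (α x)) := by
  have hi := hG.isInvertible x hx
  have hprod := fderiv_clm_comp (hG.differentiableAt_sharpAt hx) hα
  have hY := congrArg (fun T ↦ T Y) hprod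
  simp only [_root_.add_apply, ContinuousLinearMap.comp_apply, ContinuousLinearMap.flip_apply,
    ContinuousLinearMap.compL_apply] at hY
  rw [hY]
  -- the correction terms: `D♯(Y) ∘ α = −Γ_Y ∘ ♯ ∘ α − ♯ ∘ (αᵗ ∘ Γ_Y)ᵗ`
  have key : (fderiv ℝ (sharpAt G) x Y).comp (α x) =
      -((chrAt G x Y).comp ((sharpAt G x).comp (α x)))
        - (sharpAt G x).comp (((α x).flip.comp (chrAt G x Y)).flip) := by
    rw [hG.fderiv_sharpAt hx Y, hG.fderiv_eq_comp_chrAt hx Y]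
    ext v
    have h1 : ((G x).flip.comp (chrAt G x Y)).flip (sharpAt G x (α x v)) =
        ((α x).flip.comp (chrAt G x Y)).flip v := by
      ext c
      simp only [ContinuousLinearMap.flip_apply, ContinuousLinearMap.comp_apply]
      exact apply_sharpAt_apply hi _ _
    simp only [ContinuousLinearMap.neg_comp, _root_.neg_apply, _root_.sub_apply,
      ContinuousLinearMap.comp_apply, _root_.add_apply, map_add, neg_add, h1, sharpAt_apply hi]
    abel
  rw [key, cov₂At_apply₁]
  simp only [ContinuousLinearMap.comp_sub, ContinuousLinearMap.comp_assoc]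
  abel

variable [FiniteDimensional ℝ E]

/-- **Metric compatibility of the pairing of bilinear forms**: for fields `α`, `β` differentiable
at `x ∈ V`, `∂_Y ⟨α, β⟩_G = ⟨∇_Y α, β⟩_G + ⟨α, ∇_Y β⟩_G` (`pairAt G y α β = tr((♯α)(♯β))`;
O'Neill 1983, Ch. 3, p. 86: contractions commute with `∇`; Topping 2006, §2.1). [cite: ONeill1983, Ch. 3, p. 86] -/
theorem IsMetricOn.fderiv_pairAt (hG : IsMetricOn G V) (hx : x ∈ V)
    {α β : E → E →L[ℝ] E →L[ℝ] ℝ} (hα : DifferentiableAt ℝ α x) (hβ : DifferentiableAt ℝ β x) (Y : E) :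
    fderiv ℝ (fun y ↦ pairAt G y (α y) (β y)) x Y =
      pairAt G x (cov₂At G α x Y) (β x) + pairAt G x (α x) (cov₂At G β x Y) := by
  have hA : DifferentiableAt ℝ (fun y ↦ (sharpAt G y).comp (α y)) x :=
    (hG.differentiableAt_sharpAt hx).clm_comp hα
  have hB : DifferentiableAt ℝ (fun y ↦ (sharpAt G y).comp (β y)) x :=
    (hG.differentiableAt_sharpAt hx).clm_comp hβ
  have hprod := fderiv_clm_comp hA hB
  have htr : fderiv ℝ (fun y ↦ pairAt G y (α y) (β y)) x Y =
      traceCLM E (fderiv ℝ (fun y ↦ ((sharpAt G y).comp (α y)).comp ((sharpAt G y).comp (β y))) x Y) := by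
    have h := ((traceCLM E).hasFDerivAt.comp x (hA.clm_comp hB).hasFDerivAt).fderiv
    have heq : (fun y ↦ pairAt G y (α y) (β y)) =
        (traceCLM E) ∘ fun y ↦ ((sharpAt G y).comp (α y)).comp ((sharpAt G y).comp (β y)) := by
      funext y; rfl
    rw [heq, h]
    rfl
  rw [htr, hprod]
  simp only [_root_.add_apply, ContinuousLinearMap.comp_apply, ContinuousLinearMap.flip_apply,
    ContinuousLinearMap.compL_apply, hG.fderiv_sharpAt_comp hx hα, hG.fderiv_sharpAt_comp hx hβ,
    pairAt_apply]
  simp only [ContinuousLinearMap.comp_add, ContinuousLinearMap.comp_sub, ContinuousLinearMap.add_comp,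
    ContinuousLinearMap.sub_comp, map_add, map_sub]
  simp only [ContinuousLinearMap.comp_assoc]
  -- the commutator terms cancel by cyclicity of the trace
  set S := sharpAt G x with hS
  set Γ := chrAt G x Y with hΓ
  have c1 : traceCLM E (S.comp ((α x).comp (S.comp ((β x).comp Γ)))) =
      traceCLM E (Γ.comp (S.comp ((α x).comp (S.comp (β x))))) := by
    have h := traceCLM_comp_comm (S.comp ((α x).comp (S.comp (β x)))) Γ
    simp only [ContinuousLinearMap.comp_assoc] at h
    exact h
  have c2 : traceCLM E (S.comp ((α x).comp (Γ.comp (S.comp (β x))))) =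
      traceCLM E (Γ.comp (S.comp ((β x).comp (S.comp (α x))))) := by
    have s1 := traceCLM_comp_comm ((S.comp (α x)).comp Γ) (S.comp (β x))
    have s2 := traceCLM_comp_comm ((S.comp (β x)).comp (S.comp (α x))) Γ
    simp only [ContinuousLinearMap.comp_assoc] at s1 s2
    exact s1.trans s2
  rw [c1, c2]
  abel

/-! ### Quadratic functions of Lorentzian type of a tensor field: `P(β) = ½(c (tr β)² − |β|²)` -/

section Quadratic

variable {β : E → E →L[ℝ] E →L[ℝ] ℝ} {c : ℝ}


/-- `y ↦ tr_G (α y)` is differentiable at `x ∈ V` for `α` differentiable at `x`. [folklore] -/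
theorem IsMetricOn.differentiableAt_mtrAt_comp (hG : IsMetricOn G V) (hx : x ∈ V)
    {α : E → E →L[ℝ] E →L[ℝ] ℝ} (hα : DifferentiableAt ℝ α x) :
    DifferentiableAt ℝ (fun y ↦ mtrAt G y (α y)) x := by
  have h := (traceCLM E).differentiableAt.comp x ((hG.differentiableAt_sharpAt hx).clm_comp hα)
  have heq : (fun y ↦ mtrAt G y (α y)) = (traceCLM E) ∘ fun y ↦ (sharpAt G y).comp (α y) := by
    funext y; rw [Function.comp_apply, mtrAt_eq_traceCLM]
  rw [heq]; exact h

/-- `y ↦ ⟨α y, α' y⟩_G` is differentiable at `x ∈ V` for `α, α'` differentiable at `x`. [folklore] -/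
theorem IsMetricOn.differentiableAt_pairAt_comp (hG : IsMetricOn G V) (hx : x ∈ V)
    {α α' : E → E →L[ℝ] E →L[ℝ] ℝ} (hα : DifferentiableAt ℝ α x) (hα' : DifferentiableAt ℝ α' x) :
    DifferentiableAt ℝ (fun y ↦ pairAt G y (α y) (α' y)) x := by
  have hA : DifferentiableAt ℝ (fun y ↦ (sharpAt G y).comp (α y)) x :=
    (hG.differentiableAt_sharpAt hx).clm_comp hα
  have hA' : DifferentiableAt ℝ (fun y ↦ (sharpAt G y).comp (α' y)) x :=
    (hG.differentiableAt_sharpAt hx).clm_comp hα'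
  have h := (traceCLM E).differentiableAt.comp x (hA.clm_comp hA')
  have heq : (fun y ↦ pairAt G y (α y) (α' y)) =
      (traceCLM E) ∘ fun y ↦ ((sharpAt G y).comp (α y)).comp ((sharpAt G y).comp (α' y)) := by
    funext y; rfl
  rw [heq]; exact h

omit [CompleteSpace E] [FiniteDimensional ℝ E] in
/-- `∇_X` of the field `y ↦ (∇β)_y(Y;·,·)` is `(∇²_{X,Y}β) + (∇_{Γ(X,Y)}β)`. [cite: Topping2006, §2.1] -/
theorem cov₂At_cov₂At_apply {τβ : E → E →L[ℝ] E →L[ℝ] ℝ} (hβ : DifferentiableAt ℝ (cov₂At G τβ) x)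
    (X Y : E) :
    cov₂At G (fun y ↦ cov₂At G τβ y Y) x X = cov₃At G (cov₂At G τβ) x X Y + cov₂At G τβ x (chrAt G x X Y) := by
  ext A B
  rw [cov₂At_apply, _root_.add_apply, _root_.add_apply, cov₃At_apply, fderiv_clm_apply_const hβ Y X]
  ring

/-- **`∂_Y P(β) = c tr β · tr(∇_Y β) − ⟨β, ∇_Y β⟩`** for `P(β) = ½(c (tr_G β)² − ⟨β,β⟩_G)` and a field
`β` differentiable at `x ∈ V` (`∂ tr = tr ∇`, `IsMetricOn.fderiv_mtrAt`; `∂⟨β,β⟩ = 2⟨β,∇β⟩`,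
`IsMetricOn.fderiv_pairAt`). With `c = 1` this is `dσ₂(β) = ⟨T₁(β), ∇β⟩`, the first Newton
transformation `T₁ = σ₁ g − β` (Gursky–Viaclovsky 2003, §2, (derivT)). [cite: GurskyViaclovsky2003, §2] -/
theorem IsMetricOn.fderiv_quadratic (hG : IsMetricOn G V) (hx : x ∈ V) (hβ : DifferentiableAt ℝ β x)
    (Y : E) :
    fderiv ℝ (fun y ↦ 1 / 2 * (c * mtrAt G y (β y) ^ 2 - pairAt G y (β y) (β y))) x Y =
      c * mtrAt G x (β x) * mtrAt G x (cov₂At G β x Y) - pairAt G x (β x) (cov₂At G β x Y) := by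
  have htr := (hG.differentiableAt_mtrAt_comp hx hβ).hasFDerivAt
  have hpr := (hG.differentiableAt_pairAt_comp hx hβ hβ).hasFDerivAt
  have h := (((htr.pow 2).const_mul c).fun_sub hpr).const_mul (1 / 2 : ℝ)
  rw [h.fderiv]
  simp only [_root_.smul_apply, _root_.sub_apply, smul_eq_mul, nsmul_eq_mul, Nat.cast_ofNat,
    hG.fderiv_mtrAt hx hβ, hG.fderiv_pairAt hx hβ hβ, pairAt_comm G x (cov₂At G β x Y) (β x)]
  ring

/-- `P(β) = ½(c (tr β)² − ⟨β,β⟩)` is `C^∞` on `V` for `β ∈ C^∞(V)`. [folklore] -/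
theorem IsMetricOn.contDiffOn_quadratic (hG : IsMetricOn G V) (hβ : ContDiffOn ℝ ∞ β V) :
    ContDiffOn ℝ ∞ (fun y ↦ 1 / 2 * (c * mtrAt G y (β y) ^ 2 - pairAt G y (β y) (β y))) V := by
  have htr := hG.contDiffOn_mtrAt hβ
  have hA : ContDiffOn ℝ ∞ (fun y ↦ (sharpAt G y).comp (β y)) V := hG.contDiffOn_sharpAt.clm_comp hβ
  have hpr : ContDiffOn ℝ ∞ (fun y ↦ pairAt G y (β y) (β y)) V := by
    have h := (traceCLM E).contDiff.comp_contDiffOn (hA.clm_comp hA)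
    have heq : (fun y ↦ pairAt G y (β y) (β y)) =
        (traceCLM E) ∘ fun y ↦ ((sharpAt G y).comp (β y)).comp ((sharpAt G y).comp (β y)) := by
      funext y; rfl
    rw [heq]; exact h
  exact contDiffOn_const.mul ((contDiffOn_const.mul (htr.pow 2)).sub hpr)

/-- **The Hessian of `P(β) = ½(c (tr β)² − ⟨β,β⟩)`**:
`Hess P(β)(X,Y) = [c tr(∇_Xβ) tr(∇_Yβ) − ⟨∇_Xβ, ∇_Yβ⟩] + [c tr β tr(∇²_{X,Y}β) − ⟨β, ∇²_{X,Y}β⟩]`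
(the polarised form `B_c` of `2P` on the pair `(∇_Xβ, ∇_Yβ)` plus `B_c(β, ∇²_{X,Y}β)`), for
`β ∈ C^∞(V)`: differentiate `∂_Y P(β) = B_c(β, ∇_Yβ)` once more (`IsMetricOn.fderiv_mtrAt`,
`IsMetricOn.fderiv_pairAt`, `cov₂At_cov₂At_apply`); the `Γ(X,Y)` terms cancel against
`∂_{Γ(X,Y)}P(β)`. This is the computation "`F^{ij}W_{ij,kl} + F^{ij,rs}W_{ij,k}W_{rs,l} = (F(W))_{kl}`"
of Chen 2005, §3, for `F² = 2P`. [cite: Chen2005, §3] [cite: GurskyViaclovsky2003, §2] -/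
theorem IsMetricOn.hessAt_quadratic (hG : IsMetricOn G V) (hx : x ∈ V) (hβ : ContDiffOn ℝ ∞ β V)
    (X Y : E) :
    hessAt G (fun y ↦ 1 / 2 * (c * mtrAt G y (β y) ^ 2 - pairAt G y (β y) (β y))) x X Y =
      (c * mtrAt G x (cov₂At G β x X) * mtrAt G x (cov₂At G β x Y)
        - pairAt G x (cov₂At G β x X) (cov₂At G β x Y))
      + (c * mtrAt G x (β x) * mtrAt G x (cov₃At G (cov₂At G β) x X Y)
        - pairAt G x (β x) (cov₃At G (cov₂At G β) x X Y)) := by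
  set P : E → ℝ := fun y ↦ 1 / 2 * (c * mtrAt G y (β y) ^ 2 - pairAt G y (β y) (β y)) with hP
  have dβ : ∀ {y}, y ∈ V → DifferentiableAt ℝ β y := fun {y} hy ↦
    ((hβ y hy).contDiffAt (hG.mem_nhds hy)).differentiableAt (by simp)
  have hβx : ContDiffAt ℝ ∞ β x := (hβ x hx).contDiffAt (hG.mem_nhds hx)
  have hcov : DifferentiableAt ℝ (cov₂At G β) x := hG.differentiableAt_cov₂At hx hβx
  have hβY : DifferentiableAt ℝ (fun y ↦ cov₂At G β y Y) x := differentiableAt_clm_apply_const hcov Y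
  -- `∂_Z P = B_c(β, ∇_Z β)` on `V`
  have hD1 : ∀ {y}, y ∈ V → ∀ Z, fderiv ℝ P y Z =
      c * mtrAt G y (β y) * mtrAt G y (cov₂At G β y Z) - pairAt G y (β y) (cov₂At G β y Z) :=
    fun {y} hy Z ↦ hG.fderiv_quadratic hy (dβ hy) Z
  have hnear : (fun y ↦ fderiv ℝ P y Y) =ᶠ[𝓝 x]
      fun y ↦ c * (mtrAt G y (β y) * mtrAt G y (cov₂At G β y Y)) - pairAt G y (β y) (cov₂At G β y Y) := by
    filter_upwards [hG.mem_nhds hx] with y hy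
    rw [hD1 hy Y]
    ring
  -- `D²P(X,Y) = ∂_X (∂_Y P)`
  have hPc : ContDiffAt ℝ ∞ P x := (hG.contDiffOn_quadratic hβ x hx).contDiffAt (hG.mem_nhds hx)
  have hDP : DifferentiableAt ℝ (fderiv ℝ P) x :=
    (hPc.fderiv_right (m := ∞) (by simp)).differentiableAt (by simp)
  have hD2 : fderiv ℝ (fderiv ℝ P) x X Y = fderiv ℝ (fun y ↦ fderiv ℝ P y Y) x X := by
    rw [fderiv_clm_apply_const hDP Y X]
  -- the derivatives of the factors
  have d1 := (hG.differentiableAt_mtrAt_comp hx (dβ hx)).hasFDerivAt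
  have d2 := (hG.differentiableAt_mtrAt_comp hx hβY).hasFDerivAt
  have d3 := (hG.differentiableAt_pairAt_comp hx (dβ hx) hβY).hasFDerivAt
  have hder := (((d1.fun_mul d2).const_mul c).fun_sub d3).fderiv
  rw [hessAt_apply, hD2, hnear.fderiv_eq, hder, hD1 hx (chrAt G x X Y)]
  simp only [_root_.sub_apply, _root_.add_apply, _root_.smul_apply, smul_eq_mul,
    hG.fderiv_mtrAt hx (dβ hx), hG.fderiv_mtrAt hx hβY, hG.fderiv_pairAt hx (dβ hx) hβY,
    cov₂At_cov₂At_apply hcov, mtrAt_add, pairAt_add_right]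
  ring

/-- **The Laplacian of `P(β)`**, traced in a basis `b`:
`Δ P(β) = Σ g^{kl}[c tr(∇_kβ)tr(∇_lβ) − ⟨∇_kβ,∇_lβ⟩] + Σ g^{kl}[c tr β tr(∇²_{kl}β) − ⟨β,∇²_{kl}β⟩]`
(`IsMetricOn.hessAt_quadratic` summed against `g^{kl}`). The first sum is the concavity term
(nonpositive up to `|∇P|²/Q`, reverse Cauchy–Schwarz), the second is the linearised operator
applied to the rough Laplacian `Δβ`. [cite: Chen2005, §3] -/
theorem IsMetricOn.lapAt_quadratic (hG : IsMetricOn G V) (hx : x ∈ V) (hβ : ContDiffOn ℝ ∞ β V)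
    {ι : Type*} [Fintype ι] (b : Basis ι ℝ E) :
    lapAt G (fun y ↦ 1 / 2 * (c * mtrAt G y (β y) ^ 2 - pairAt G y (β y) (β y))) x =
      ∑ k, ∑ l, ginv G b x k l *
        (c * mtrAt G x (cov₂At G β x (b k)) * mtrAt G x (cov₂At G β x (b l))
          - pairAt G x (cov₂At G β x (b k)) (cov₂At G β x (b l)))
      + ∑ k, ∑ l, ginv G b x k l *
        (c * mtrAt G x (β x) * mtrAt G x (cov₃At G (cov₂At G β) x (b k) (b l))
          - pairAt G x (β x) (cov₃At G (cov₂At G β) x (b k) (b l))) := by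
  rw [lapAt_eq_sum G b]
  simp only [← Finset.sum_add_distrib, ← mul_add]
  refine Finset.sum_congr rfl fun k _ ↦ Finset.sum_congr rfl fun l _ ↦ ?_
  rw [← hessAt_apply, hG.hessAt_quadratic hx hβ]

end Quadratic

end MetricCoord

end Literature.Geometry.Lorentzian

end
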